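import Literature.Geometry.Riemannian.HamiltonODEPositiveCone
import HarnessLib

/-!
# Negative lemma for crux `ChangGurskyYang` (stmt-SmoothPoincare4-10834): the block-polynomial
# form of Margerin's weak-pinching monotonicity is FALSE when typed over ALL block triples

Supports the crux item as a `stub_false`-type fact (refuter, cdisprove gen 2). The round-1 idea
card `margerin-certified-cone` (ideator 3, `Cruxes/ChangGurskyYang/SketchIdeator3.lean`) types its
FIRST LEMMA — Margerin 1998, Prop. 4 / Lemma 9, "the fundamental polynomial is non-positive on
`1/6`-weakly pinched curvature" — as the inequalities `Sketch3.MargerinPolynomialNonpos` /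
`Sketch3.MargerinPolynomialNeg`, quantified over EVERY block triple `(A, B, C) ∈ (ℝ^{3×3})³` of
Hamilton's ODE `(A, B, C)' = (A² + BBᵀ + 2A^#, AB + BC + 2B^#, C² + BᵀB + 2C^#)`
(`Literature.Geometry.Riemannian.HamiltonODE.field`) with `tr A + tr C > 0` and
`‖tf A‖² + ‖tf C‖² + 2‖B‖² ≤ (1/6)(tr A + tr C)²` (`tf` = trace-free part, Frobenius norms).
Margerin's statement concerns ALGEBRAIC CURVATURE OPERATORS, whose diagonal blocks `A` (on `Λ²₊`)
and `C` (on `Λ²₋`) are SYMMETRIC (and `tr A = tr C`, Bianchi); dropping the symmetry makes the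
inequality false:

* `margerinPolynomialNonpos_asTyped_false`, `margerinPolynomialNeg_asTyped_false` — the two sketch
  statements, with the sketch's definitions `frob`, `frobInner`, `tf`, `wpNum`, `scalB`, `dWpNum`
  unfolded into `let`s with the same bodies (this file declares no definition and no notation), are
  refuted by the integer witness `A = !![2,0,1; 1,1,-1; -1,1,1]` (not symmetric), `B = 0`, `C = 1`:
  `tr A + tr C = 7 > 0`, `‖tf A‖² + ‖tf C‖² + 2‖B‖² = 17/3 < 49/6`,
  `field = (!![7,1,7; 6,6,-5; -4,8,3], 0, 3·1)` (`field_witness`), and fundamental polynomial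
  `D = (190/3)·49 - (17/3)·(2·7·25) = 1120 > 0`.

The intended (repaired) lemma restricts to `A = Aᵀ`, `C = Cᵀ`, `tr A = tr C` — ideator 2's
`margerinP2_nonpos` — which an independent adversarial search did not break
(`Cruxes/ChangGurskyYang/Disproof.lean` §9).

## References

* C. Margerin, *A sharp characterization of the smooth 4-sphere in curvature terms*, Comm. Anal.
  Geom. 6 (1998) 21–65, Prop. 4, Lemma 9. [Margerin1998]
* R. S. Hamilton, *Four-manifolds with positive curvature operator*, J. Differential Geom. 24
  (1986) 153–179, §2 p. 157 (`M^#`), §6 p. 166 (the block system). [Hamilton1986]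
-/

noncomputable section

open scoped Matrix BigOperators
open Literature.Geometry.Riemannian

namespace Summit.SmoothPoincare4.SmoothPoincare4.Theorems.ChangGurskyYang.Negative

set_option linter.dupNamespace false

/-- `A^# = !![2,0,2; 1,3,-2; -1,3,2]` for the witness `A = !![2,0,1; 1,1,-1; -1,1,1]` (cofactor
matrix). [cite: Hamilton1986, §2, p. 157] -/
theorem sharp_witness :
    (!![2, 0, 1; 1, 1, -1; -1, 1, 1] : Matrix (Fin 3) (Fin 3) ℝ).sharp =
      !![2, 0, 2; 1, 3, -2; -1, 3, 2] := by
  ext i j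
  fin_cases i <;> fin_cases j <;>
    simp [Matrix.sharp, Matrix.adjugate_fin_three] <;> norm_num

/-- `1^# = 1` for `3 × 3` matrices. [folklore] -/
theorem sharp_one_fin_three : (1 : Matrix (Fin 3) (Fin 3) ℝ).sharp = 1 := by
  simp [Matrix.sharp]

/-- **Hamilton's ODE at the witness**: `field (A, 0, 1) = (A² + 2A^#, 0, 1 + 2·1^#) =
(!![7,1,7; 6,6,-5; -4,8,3], 0, 3·1)`. [cite: Hamilton1986, §6, p. 166] -/
theorem field_witness :
    HamiltonODE.field ((!![2, 0, 1; 1, 1, -1; -1, 1, 1] : Matrix (Fin 3) (Fin 3) ℝ), 0, 1) =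
      (!![7, 1, 7; 6, 6, -5; -4, 8, 3], 0, !![3, 0, 0; 0, 3, 0; 0, 0, 3]) := by
  simp only [HamiltonODE.field]
  refine Prod.ext ?_ (Prod.ext ?_ ?_)
  · rw [sharp_witness]
    ext i j
    fin_cases i <;> fin_cases j <;> simp <;> norm_num
  · simp [HamiltonODE.sharp_zero]
  · rw [sharp_one_fin_three]
    ext i j
    fin_cases i <;> fin_cases j <;> simp <;> norm_num

/-- **`Sketch3.MargerinPolynomialNonpos` as typed is FALSE.** The statement below is the sketch's,
with its definitions unfolded (`tf M = M - (tr M/3)•1`, `wpNum = ‖tf A‖² + ‖tf C‖² + 2‖B‖²`,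
`scalB = tr A + tr C`, `dWpNum = 2⟨tf A, tf A'⟩ + 2⟨tf C, tf C'⟩ + 4⟨B, B'⟩`, `(A', B', C') =
field (A, B, C)`); it omits the symmetry of `A`, `C` and is refuted by `(A, 0, 1)`,
`A = !![2,0,1; 1,1,-1; -1,1,1]`: `scalB = 7`, `wpNum = 17/3 ≤ 49/6`, `D = 1120 > 0`. Repair:
restrict to `A = Aᵀ`, `C = Cᵀ`, `tr A = tr C`. [cite: Margerin1998, Prop. 4] -/
theorem margerinPolynomialNonpos_asTyped_false :
    ¬ (∀ p : HamiltonODE.Blocks,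
        let q : HamiltonODE.Blocks := HamiltonODE.field p
        let tfA : Matrix (Fin 3) (Fin 3) ℝ := p.1 - (p.1.trace / 3) • (1 : Matrix (Fin 3) (Fin 3) ℝ)
        let tfC : Matrix (Fin 3) (Fin 3) ℝ := p.2.2 - (p.2.2.trace / 3) • (1 : Matrix (Fin 3) (Fin 3) ℝ)
        let tfA' : Matrix (Fin 3) (Fin 3) ℝ := q.1 - (q.1.trace / 3) • (1 : Matrix (Fin 3) (Fin 3) ℝ)
        let tfC' : Matrix (Fin 3) (Fin 3) ℝ := q.2.2 - (q.2.2.trace / 3) • (1 : Matrix (Fin 3) (Fin 3) ℝ)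
        let wpNum : ℝ := (∑ i, ∑ j, tfA i j ^ 2) + (∑ i, ∑ j, tfC i j ^ 2) + 2 * ∑ i, ∑ j, p.2.1 i j ^ 2
        let scalB : ℝ := p.1.trace + p.2.2.trace
        let scalB' : ℝ := q.1.trace + q.2.2.trace
        let dWpNum : ℝ := 2 * (∑ i, ∑ j, tfA i j * tfA' i j) + 2 * (∑ i, ∑ j, tfC i j * tfC' i j) +
          4 * ∑ i, ∑ j, p.2.1 i j * q.2.1 i j
        0 < scalB → wpNum ≤ (1 / 6 : ℝ) * scalB ^ 2 →
          dWpNum * scalB ^ 2 - wpNum * (2 * scalB * scalB') ≤ 0) := by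
  intro h
  have h3 := h ((!![2, 0, 1; 1, 1, -1; -1, 1, 1] : Matrix (Fin 3) (Fin 3) ℝ), 0, 1)
  dsimp only at h3
  rw [field_witness] at h3
  simp [Matrix.trace, Fin.sum_univ_three, Matrix.sub_apply, Matrix.smul_apply, Matrix.one_apply] at h3
  norm_num at h3

/-- **`Sketch3.MargerinPolynomialNeg` as typed is FALSE** (same unfolding, same witness:
`0 < 17/3 < 49/6`, `D = 1120 ≮ 0`). [cite: Margerin1998, Lemma 9] -/
theorem margerinPolynomialNeg_asTyped_false :
    ¬ (∀ p : HamiltonODE.Blocks,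
        let q : HamiltonODE.Blocks := HamiltonODE.field p
        let tfA : Matrix (Fin 3) (Fin 3) ℝ := p.1 - (p.1.trace / 3) • (1 : Matrix (Fin 3) (Fin 3) ℝ)
        let tfC : Matrix (Fin 3) (Fin 3) ℝ := p.2.2 - (p.2.2.trace / 3) • (1 : Matrix (Fin 3) (Fin 3) ℝ)
        let tfA' : Matrix (Fin 3) (Fin 3) ℝ := q.1 - (q.1.trace / 3) • (1 : Matrix (Fin 3) (Fin 3) ℝ)
        let tfC' : Matrix (Fin 3) (Fin 3) ℝ := q.2.2 - (q.2.2.trace / 3) • (1 : Matrix (Fin 3) (Fin 3) ℝ)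
        let wpNum : ℝ := (∑ i, ∑ j, tfA i j ^ 2) + (∑ i, ∑ j, tfC i j ^ 2) + 2 * ∑ i, ∑ j, p.2.1 i j ^ 2
        let scalB : ℝ := p.1.trace + p.2.2.trace
        let scalB' : ℝ := q.1.trace + q.2.2.trace
        let dWpNum : ℝ := 2 * (∑ i, ∑ j, tfA i j * tfA' i j) + 2 * (∑ i, ∑ j, tfC i j * tfC' i j) +
          4 * ∑ i, ∑ j, p.2.1 i j * q.2.1 i j
        0 < scalB → 0 < wpNum → wpNum < (1 / 6 : ℝ) * scalB ^ 2 →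
          dWpNum * scalB ^ 2 - wpNum * (2 * scalB * scalB') < 0) := by
  intro h
  have h3 := h ((!![2, 0, 1; 1, 1, -1; -1, 1, 1] : Matrix (Fin 3) (Fin 3) ℝ), 0, 1)
  dsimp only at h3
  rw [field_witness] at h3
  simp [Matrix.trace, Fin.sum_univ_three, Matrix.sub_apply, Matrix.smul_apply, Matrix.one_apply] at h3
  norm_num at h3

end Summit.SmoothPoincare4.SmoothPoincare4.Theorems.ChangGurskyYang.Negative

end
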